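import Literature.Probability.LatticeModels.MTP2WeakClosure
import HarnessLib

/-!
# Markov chains with MTP₂ initial and transition densities (Colangelo–Müller–Scarsini, Theorem 7)

[cite: ColangeloMullerScarsini2006, §5 Thm. 7]: let `X₀, X₁, …` be a homogeneous Markov chain on `ℝ^d` whose
initial law and transition kernel have densities `f₀` and `q(x, ·)` with respect to a product measure `µ` on `ℝ^d`.
"If `f₀ : ℝ^d → [0,∞)` and `q : ℝ^{2d} → [0,∞)` are MTP₂ functions, then (a) the joint distribution of
`X₁, …, Xₙ` is MTP₂ for any `n`; (b) the marginal distribution `πₙ` of `Xₙ` is MTP₂; (c) if, moreover, `πₙ`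
converges to a stationary distribution `π`, then `π` is MTP₂."  Parts (a), (b) "are well known" (Karlin–Rinott:
the joint density `f₁(y₁) f₂(y₂,y₁) ⋯ fₙ(yₙ,yₙ₋₁)` of a Markov sequence with TP₂ transition densities "is MTP₂ by
Proposition 3.3" [cite: KarlinRinott1980, §3, Prop. 3.10 and its proof]); (c) is Theorem 2 there
(`mIsSetTP2_stationary` in `MTP2WeakClosure.lean`).

Here (a) and (b) are proved in the tree's vocabulary.  The joint law of `(X₀, …, Xₙ)` is, by definition of the
chain, the measure on the time–space configuration lattice `ℝ^{Fin (n+1) × ι}` with density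
`F(x) = f₀(x₀) ∏_{i<n} q(xᵢ, xᵢ₊₁)` with respect to the product reference measure `⊗_{(i,j)} µ_j`:

* `mtp2_mul`, `mtp2_finset_prod` — products of MTP₂ functions are MTP₂ [cite: KarlinRinott1980, (1.14)];
* `mIsSetTP2_markovJointDensity` — **Theorem 7 (a)**: that measure is MTP₂ (Definition 2), via Müller–Stoyan
  Thm. 3.10.14 (i) ⇒ (ii) (`mIsSetTP2_withDensity_pi`);
* `mIsSetTP2.map_timeSlice` — the law of any single time slice of an MTP₂ law on `ℝ^{N × ι}` is MTP₂ (B7/B4-type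
  push-forward along a lattice homomorphism), whence **Theorem 7 (b)** `mIsSetTP2_markovMarginal`.
-/

noncomputable section

namespace Literature.Probability.LatticeModels.Affiliation

open MeasureTheory Set
open scoped ENNReal

section MTP2Functions

variable {Ω : Type*} [Lattice Ω]

/-- **A product of two MTP₂ functions is MTP₂.** [cite: KarlinRinott1980, (1.14)] -/
theorem mtp2_mul {f g : Ω → ℝ≥0∞} (hf : ∀ x y, f x * f y ≤ f (x ⊓ y) * f (x ⊔ y))
    (hg : ∀ x y, g x * g y ≤ g (x ⊓ y) * g (x ⊔ y)) (x y : Ω) :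
    f x * g x * (f y * g y) ≤ f (x ⊓ y) * g (x ⊓ y) * (f (x ⊔ y) * g (x ⊔ y)) :=
  calc f x * g x * (f y * g y) = f x * f y * (g x * g y) := mul_mul_mul_comm _ _ _ _
    _ ≤ f (x ⊓ y) * f (x ⊔ y) * (g (x ⊓ y) * g (x ⊔ y)) := mul_le_mul' (hf x y) (hg x y)
    _ = f (x ⊓ y) * g (x ⊓ y) * (f (x ⊔ y) * g (x ⊔ y)) := mul_mul_mul_comm _ _ _ _

/-- **A finite product of MTP₂ functions is MTP₂.** [cite: KarlinRinott1980, (1.14)] -/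
theorem mtp2_finset_prod {κ : Type*} (s : Finset κ) {f : κ → Ω → ℝ≥0∞}
    (hf : ∀ k ∈ s, ∀ x y, f k x * f k y ≤ f k (x ⊓ y) * f k (x ⊔ y)) :
    ∀ x y : Ω, (∏ k ∈ s, f k x) * ∏ k ∈ s, f k y ≤ (∏ k ∈ s, f k (x ⊓ y)) * ∏ k ∈ s, f k (x ⊔ y) := by
  classical
  induction s using Finset.induction_on with
  | empty => intro x y; simp
  | insert a s ha ih =>
    intro x y
    simp only [Finset.prod_insert ha]
    exact mtp2_mul (hf a (Finset.mem_insert_self a s))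
      (ih fun k hk => hf k (Finset.mem_insert_of_mem hk)) x y

end MTP2Functions

section Markov

variable {ι : Type*} [Fintype ι]

omit [Fintype ι] in
/-- **The law of a time slice of an MTP₂ law is MTP₂**: for any measure on the time–space lattice `ℝ^{N × ι}`
that is MTP₂ (Definition 2), the push-forward along `x ↦ x(i, ·)` is MTP₂ (the slice map is a measurable lattice
homomorphism; cf. B7). [cite: ColangeloMullerScarsini2006, Thm. 3 (B7) and Thm. 7 (b)] -/
theorem mIsSetTP2.map_timeSlice {N : Type*} [Countable N] [Countable ι] {μ : Measure (N × ι → ℝ)}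
    (hμ : mIsSetTP2 μ) (i : N) : mIsSetTP2 (μ.map fun x : N × ι → ℝ => fun j : ι => x (i, j)) :=
  hμ.map_of_map_sup_inf (measurable_pi_lambda _ fun j => measurable_pi_apply (i, j)) (fun _ _ => rfl)
    (fun _ _ => rfl)

/-- **Theorem 7 (a) of Colangelo–Müller–Scarsini.**  Let `µ_j` (`j ∈ ι`) be σ-finite reference measures on `ℝ`,
`f₀ : ℝ^ι → [0,∞]` an MTP₂ initial density and `q : ℝ^ι × ℝ^ι → [0,∞]` an MTP₂ transition density (MTP₂ on the
product lattice `ℝ^{2ι}`), both measurable.  Then the joint law of `(X₀, …, Xₙ)` — the measure on `ℝ^{Fin (n+1) × ι}`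
with density `F(x) = f₀(x₀) ∏_{i<n} q(xᵢ, xᵢ₊₁)` with respect to `⊗_{(i,j)} µ_j` — is MTP₂ (Definition 2): `F`
is a product of MTP₂ functions, and an MTP₂ density with respect to a product measure defines an MTP₂ law.
[cite: ColangeloMullerScarsini2006, Thm. 7 (a); KarlinRinott1980, §3, Prop. 3.10 (proof: "MTP₂ by Proposition
3.3"); MullerStoyan2002, Thm. 3.10.14] -/
theorem mIsSetTP2_markovJointDensity (m : ι → Measure ℝ) [∀ j, SigmaFinite (m j)] (n : ℕ)
    {f₀ : (ι → ℝ) → ℝ≥0∞} {q : (ι → ℝ) → (ι → ℝ) → ℝ≥0∞} (hf₀m : Measurable f₀)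
    (hqm : Measurable (Function.uncurry q)) (hf₀ : ∀ x y, f₀ x * f₀ y ≤ f₀ (x ⊓ y) * f₀ (x ⊔ y))
    (hq : ∀ x x' y y', q x y * q x' y' ≤ q (x ⊓ x') (y ⊓ y') * q (x ⊔ x') (y ⊔ y')) :
    mIsSetTP2 ((Measure.pi fun p : Fin (n + 1) × ι => m p.2).withDensity fun x =>
      f₀ (fun j => x (0, j)) *
        ∏ i : Fin n, q (fun j => x (Fin.castSucc i, j)) (fun j => x (Fin.succ i, j))) := by
  have hslice : ∀ i : Fin (n + 1), Measurable fun x : Fin (n + 1) × ι → ℝ => fun j : ι => x (i, j) :=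
    fun i => measurable_pi_lambda _ fun j => measurable_pi_apply (i, j)
  refine mIsSetTP2_withDensity_pi _ _ ?_ ?_
  · refine (hf₀m.comp (hslice 0)).mul (Finset.measurable_prod _ fun i _ => ?_)
    exact hqm.comp ((hslice (Fin.castSucc i)).prodMk (hslice (Fin.succ i)))
  · intro x y
    exact mtp2_mul (f := fun x : Fin (n + 1) × ι → ℝ => f₀ fun j => x (0, j))
      (g := fun x : Fin (n + 1) × ι → ℝ =>
        ∏ i : Fin n, q (fun j => x (Fin.castSucc i, j)) (fun j => x (Fin.succ i, j)))
      (fun x y => hf₀ _ _)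
      (fun x y => mtp2_finset_prod Finset.univ
        (f := fun (i : Fin n) (x : Fin (n + 1) × ι → ℝ) =>
          q (fun j => x (Fin.castSucc i, j)) (fun j => x (Fin.succ i, j)))
        (fun i _ x y => hq _ _ _ _) x y) x y

/-- **Theorem 7 (b) of Colangelo–Müller–Scarsini**: under the hypotheses of (a), the marginal law `πᵢ` of `Xᵢ`
(every `i ≤ n`) is MTP₂.  (With (c) = `mIsSetTP2_stationary`: MTP₂ stationary limits.)
[cite: ColangeloMullerScarsini2006, Thm. 7 (b); KarlinRinott1980, §3, Prop. 3.10] -/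
theorem mIsSetTP2_markovMarginal (m : ι → Measure ℝ) [∀ j, SigmaFinite (m j)] (n : ℕ)
    {f₀ : (ι → ℝ) → ℝ≥0∞} {q : (ι → ℝ) → (ι → ℝ) → ℝ≥0∞} (hf₀m : Measurable f₀)
    (hqm : Measurable (Function.uncurry q)) (hf₀ : ∀ x y, f₀ x * f₀ y ≤ f₀ (x ⊓ y) * f₀ (x ⊔ y))
    (hq : ∀ x x' y y', q x y * q x' y' ≤ q (x ⊓ x') (y ⊓ y') * q (x ⊔ x') (y ⊔ y')) (i : Fin (n + 1)) :
    mIsSetTP2 (((Measure.pi fun p : Fin (n + 1) × ι => m p.2).withDensity fun x =>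
      f₀ (fun j => x (0, j)) *
        ∏ i : Fin n, q (fun j => x (Fin.castSucc i, j)) (fun j => x (Fin.succ i, j))).map
      fun x : Fin (n + 1) × ι → ℝ => fun j : ι => x (i, j)) :=
  (mIsSetTP2_markovJointDensity m n hf₀m hqm hf₀ hq).map_timeSlice i

end Markov

end Literature.Probability.LatticeModels.Affiliation
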